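import Summits.QuantumFields.YangMills.Theorems.QuantileBitPurityFluxReflectionForm
import HarnessLib

/-!
# Flux reflection IV: a twisted EVEN kernel ring is controlled by the untwisted ring's sign-flip and zero weights

Support module (`--supports` stmt-QuantumFields-24093, `QuantileBitPurity.EquatorBandVanishing`; seat ym-dw-p1 g17).  The even-length companion of
`QuantileBitPurityFluxReflectionOdd`: the two half rings meet in a middle SLICE instead of a middle bond, so plain `L²(ρ)` Cauchy–Schwarz suffices (no kernel
positivity needed) and there is no middle-bond term.  For `Ψ ≥ 0` bounded, jointly measurable and symmetric, `T` measure preserving and `O` odd under `T`: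

★ `twisted_le_even`: `∫Ψ(x,a)Ψ(a,Tx) ≤ (∫ΨΨ)^{1/2}·(2(∫Ψ𝟙_{flip}Ψ)^{1/2} + (∫𝟙_{O=0}ΨΨ)^{1/2})`,

with the even ring weight `V[H,S] = ∫dx ∫da Ψ(x,a) H(x,a) Ψ(a, S x)` and its monotonicity ∕ additivity (`weight0_mono`, `weight0_add`).
Pure measure theory (Mathlib only).  HONEST FRAMING: an inequality between integrals; nothing about infinite volume, the continuum limit or the Clay gap.
No `sorry`, no new axiom, no new definition.  References: [folklore]; E. T. Tomboulis, L. G. Yaffe, CMP 100 (1985) 313.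
-/

set_option autoImplicit false

noncomputable section

open MeasureTheory Real Function Set

namespace Summit.QuantumFields.YangMills.Theorems.FemtoTransferGap.FluxReflection

variable {Y : Type*} [MeasurableSpace Y] {ρ : Measure Y} [IsFiniteMeasure ρ]

/-! ## §7 The even ring: middle slice instead of middle bond -/

section Even

variable {Ψ : Y → Y → ℝ} {CΨ : ℝ}

/-- Measurability of `x ↦ ∫ (P(x,a)F(x,a)) (Q(x,a)G(x,a)) da`. [folklore] -/
theorem measurable_pq0 {P Q F G : Y → Y → ℝ} (hP : Measurable (uncurry P)) (hQ : Measurable (uncurry Q))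
    (hF : Measurable (uncurry F)) (hG : Measurable (uncurry G)) :
    Measurable fun x => ∫ a, (P x a * F x a) * (Q x a * G x a) ∂ρ :=
  (((hP.mul hF).mul (hQ.mul hG)).stronglyMeasurable.integral_prod_right' (ν := ρ)).measurable

/-- Bound. [folklore] -/
theorem abs_pq0_le {P Q F G : Y → Y → ℝ} {C : ℝ} (hPb : ∀ x a, |P x a| ≤ C) (hQb : ∀ x a, |Q x a| ≤ C)
    (hFb : ∀ x a, |F x a| ≤ 1) (hGb : ∀ x a, |G x a| ≤ 1) (x : Y) :
    |∫ a, (P x a * F x a) * (Q x a * G x a) ∂ρ| ≤ C * C * ρ.real univ := by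
  have hC : 0 ≤ C := (abs_nonneg _).trans (hPb x x)
  have h := norm_integral_le_of_norm_le_const (μ := ρ) (f := fun a => (P x a * F x a) * (Q x a * G x a)) (C := C * C)
    (ae_of_all _ fun a => by
      rw [Real.norm_eq_abs, abs_mul, abs_mul, abs_mul]
      exact mul_le_mul ((mul_le_mul (hPb x a) (hFb x a) (abs_nonneg _) hC).trans (by rw [mul_one]))
        ((mul_le_mul (hQb x a) (hGb x a) (abs_nonneg _) hC).trans (by rw [mul_one])) (mul_nonneg (abs_nonneg _) (abs_nonneg _)) hC)
  rw [Real.norm_eq_abs] at h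
  linarith [h]

omit [IsFiniteMeasure ρ] in
/-- Non-negativity. [folklore] -/
theorem pq0_nonneg {P Q F G : Y → Y → ℝ} (hP0 : ∀ x a, 0 ≤ P x a) (hQ0 : ∀ x a, 0 ≤ Q x a)
    (hF0 : ∀ x a, 0 ≤ F x a) (hG0 : ∀ x a, 0 ≤ G x a) (x : Y) :
    0 ≤ ∫ a, (P x a * F x a) * (Q x a * G x a) ∂ρ :=
  integral_nonneg fun a => mul_nonneg (mul_nonneg (hP0 x a) (hF0 x a)) (mul_nonneg (hQ0 x a) (hG0 x a))

/-- `L²` Cauchy–Schwarz for non-negative bounded measurable `u, v`: `∫ u v ≤ (∫ u u)^{1/2} (∫ v v)^{1/2}`. [folklore] -/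
theorem integral_mul_le_sqrt {u v : Y → ℝ} (hu : Measurable u) (hv : Measurable v) (hu0 : ∀ a, 0 ≤ u a) (hv0 : ∀ a, 0 ≤ v a)
    {Cu Cv : ℝ} (hub : ∀ a, u a ≤ Cu) (hvb : ∀ a, v a ≤ Cv) :
    ∫ a, u a * v a ∂ρ ≤ Real.sqrt (∫ a, u a * u a ∂ρ) * Real.sqrt (∫ a, v a * v a ∂ρ) := by
  have h := integral_sqrt_mul_sqrt_le (ρ := ρ) (f := fun a => u a * u a) (g := fun a => v a * v a) (hu.mul hu) (hv.mul hv)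
    (fun a => mul_nonneg (hu0 a) (hu0 a)) (fun a => mul_nonneg (hv0 a) (hv0 a)) (Cf := Cu * Cu) (Cg := Cv * Cv)
    (fun a => mul_le_mul (hub a) (hub a) (hu0 a) ((hu0 a).trans (hub a))) (fun a => mul_le_mul (hvb a) (hvb a) (hv0 a) ((hv0 a).trans (hvb a)))
  have e : ∀ a, Real.sqrt (u a * u a) * Real.sqrt (v a * v a) = u a * v a := fun a => by
    rw [Real.sqrt_mul_self (hu0 a), Real.sqrt_mul_self (hv0 a)]
  simp only [e] at h
  exact h

/-- Pointwise Cauchy–Schwarz for the even ring. [folklore] -/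
theorem inner0_le (hΨm : Measurable (uncurry Ψ)) (hΨb : ∀ x a, |Ψ x a| ≤ CΨ) (hΨ0 : ∀ x a, 0 ≤ Ψ x a)
    {f g : Y → ℝ} (hf : Measurable f) (hg : Measurable g) (hf0 : ∀ a, 0 ≤ f a) (hf1 : ∀ a, f a ≤ 1) (hg0 : ∀ a, 0 ≤ g a) (hg1 : ∀ a, g a ≤ 1)
    (x y : Y) :
    ∫ a, (Ψ x a * f a) * (Ψ a y * g a) ∂ρ ≤
      Real.sqrt (∫ a, (Ψ x a * f a) * (Ψ x a * f a) ∂ρ) * Real.sqrt (∫ a, (Ψ a y * g a) * (Ψ a y * g a) ∂ρ) := by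
  have hC0 : 0 ≤ CΨ := (abs_nonneg _).trans (hΨb x x)
  exact integral_mul_le_sqrt (ρ := ρ) ((hΨm.comp (measurable_const.prodMk measurable_id)).mul hf)
    ((hΨm.comp (measurable_id.prodMk measurable_const)).mul hg) (fun a => mul_nonneg (hΨ0 x a) (hf0 a))
    (fun a => mul_nonneg (hΨ0 a y) (hg0 a)) (Cu := CΨ) (Cv := CΨ)
    (fun a => (mul_le_mul ((le_abs_self _).trans (hΨb x a)) (hf1 a) (hf0 a) hC0).trans (by rw [mul_one]))
    (fun a => (mul_le_mul ((le_abs_self _).trans (hΨb a y)) (hg1 a) (hg0 a) hC0).trans (by rw [mul_one]))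

/-- One Cauchy–Schwarz term of the even ring. [folklore] -/
theorem cs_term0 (hΨm : Measurable (uncurry Ψ)) (hΨb : ∀ x a, |Ψ x a| ≤ CΨ) (hΨ0 : ∀ x a, 0 ≤ Ψ x a) (hΨs : ∀ x a, Ψ x a = Ψ a x)
    {S : Y → Y} (hS : MeasurePreserving S ρ ρ) {f g : Y → Y → ℝ} (hf : Measurable (uncurry f)) (hg : Measurable (uncurry g))
    (hf0 : ∀ x a, 0 ≤ f x a) (hf1 : ∀ x a, f x a ≤ 1) (hg0 : ∀ x a, 0 ≤ g x a) (hg1 : ∀ x a, g x a ≤ 1) :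
    ∫ x, ∫ a, (Ψ x a * f x a) * (Ψ a (S x) * g (S x) a) ∂ρ ∂ρ ≤
      Real.sqrt (∫ x, ∫ a, (Ψ x a * f x a) * (Ψ a x * f x a) ∂ρ ∂ρ) *
        Real.sqrt (∫ x, ∫ a, (Ψ x a * g x a) * (Ψ a x * g x a) ∂ρ ∂ρ) := by
  have hSm : Measurable S := hS.measurable
  have hfb : ∀ x a, |f x a| ≤ 1 := fun x a => by rw [abs_of_nonneg (hf0 x a)]; exact hf1 x a
  have hgb : ∀ x a, |g x a| ≤ 1 := fun x a => by rw [abs_of_nonneg (hg0 x a)]; exact hg1 x a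
  set A : Y → ℝ := fun x => ∫ a, (Ψ x a * f x a) * (Ψ a x * f x a) ∂ρ with hA
  set Φ : Y → ℝ := fun y => ∫ a, (Ψ y a * g y a) * (Ψ a y * g y a) ∂ρ with hΦ
  have hΨm' : Measurable (uncurry fun x a => Ψ a x) := hΨm.comp (measurable_snd.prodMk measurable_fst)
  have hAm : Measurable A := measurable_pq0 (ρ := ρ) hΨm hΨm' hf hf
  have hΦm : Measurable Φ := measurable_pq0 (ρ := ρ) hΨm hΨm' hg hg
  have hA0 : ∀ x, 0 ≤ A x := fun x => pq0_nonneg (ρ := ρ) hΨ0 (fun x a => hΨ0 a x) hf0 hf0 x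
  have hΦ0 : ∀ x, 0 ≤ Φ x := fun x => pq0_nonneg (ρ := ρ) hΨ0 (fun x a => hΨ0 a x) hg0 hg0 x
  have hAb : ∀ x, A x ≤ CΨ * CΨ * ρ.real univ := fun x => (le_abs_self _).trans (abs_pq0_le (ρ := ρ) hΨb (fun x a => hΨb a x) hfb hfb x)
  have hΦb : ∀ x, Φ x ≤ CΨ * CΨ * ρ.real univ := fun x => (le_abs_self _).trans (abs_pq0_le (ρ := ρ) hΨb (fun x a => hΨb a x) hgb hgb x)
  have hpt : ∀ x, ∫ a, (Ψ x a * f x a) * (Ψ a (S x) * g (S x) a) ∂ρ ≤ Real.sqrt (A x) * Real.sqrt (Φ (S x)) := by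
    intro x
    have h := inner0_le (ρ := ρ) (f := fun a => f x a) (g := fun a => g (S x) a) hΨm hΨb hΨ0 (hf.comp (measurable_const.prodMk measurable_id))
      (hg.comp (measurable_const.prodMk measurable_id)) (hf0 x) (hf1 x) (hg0 (S x)) (hg1 (S x)) x (S x)
    have e1 : ∫ a, (Ψ x a * f x a) * (Ψ x a * f x a) ∂ρ = A x := by
      simp only [hA]
      exact integral_congr_ae (ae_of_all _ fun a => by dsimp only; rw [hΨs a x])
    have e2 : ∫ a, (Ψ a (S x) * g (S x) a) * (Ψ a (S x) * g (S x) a) ∂ρ = Φ (S x) := by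
      simp only [hΦ]
      exact integral_congr_ae (ae_of_all _ fun a => by dsimp only; rw [hΨs (S x) a])
    rw [e1, e2] at h
    exact h
  have hLm : Measurable fun x => ∫ a, (Ψ x a * f x a) * (Ψ a (S x) * g (S x) a) ∂ρ :=
    measurable_pq0 (ρ := ρ) hΨm (hΨm.comp (measurable_snd.prodMk (hSm.comp measurable_fst))) hf (hg.comp ((hSm.comp measurable_fst).prodMk measurable_snd))
  have hLb : ∀ x, |∫ a, (Ψ x a * f x a) * (Ψ a (S x) * g (S x) a) ∂ρ| ≤ CΨ * CΨ * ρ.real univ :=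
    fun x => abs_pq0_le (ρ := ρ) hΨb (fun x a => hΨb a (S x)) hfb (fun x a => hgb (S x) a) x
  have hLi : Integrable (fun x => ∫ a, (Ψ x a * f x a) * (Ψ a (S x) * g (S x) a) ∂ρ) ρ :=
    Integrable.of_bound hLm.aestronglyMeasurable _ (ae_of_all _ fun x => by rw [Real.norm_eq_abs]; exact hLb x)
  set Cb : ℝ := CΨ * CΨ * ρ.real univ with hCb
  have hRm : Measurable fun x => Real.sqrt (A x) * Real.sqrt (Φ (S x)) := hAm.sqrt.mul (hΦm.comp hSm).sqrt
  have hRi : Integrable (fun x => Real.sqrt (A x) * Real.sqrt (Φ (S x))) ρ := by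
    refine Integrable.of_bound hRm.aestronglyMeasurable (Real.sqrt Cb * Real.sqrt Cb) (ae_of_all _ fun x => ?_)
    rw [Real.norm_eq_abs, abs_of_nonneg (mul_nonneg (Real.sqrt_nonneg _) (Real.sqrt_nonneg _))]
    exact mul_le_mul (Real.sqrt_le_sqrt (hAb x)) (Real.sqrt_le_sqrt (hΦb (S x))) (Real.sqrt_nonneg _) (Real.sqrt_nonneg _)
  calc ∫ x, ∫ a, (Ψ x a * f x a) * (Ψ a (S x) * g (S x) a) ∂ρ ∂ρ
      ≤ ∫ x, Real.sqrt (A x) * Real.sqrt (Φ (S x)) ∂ρ := integral_mono hLi hRi hpt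
    _ ≤ Real.sqrt (∫ x, A x ∂ρ) * Real.sqrt (∫ x, Φ (S x) ∂ρ) :=
        integral_sqrt_mul_sqrt_le hAm (hΦm.comp hSm) hA0 (fun x => hΦ0 (S x)) hAb (fun x => hΦb (S x))
    _ = Real.sqrt (∫ x, A x ∂ρ) * Real.sqrt (∫ x, Φ x ∂ρ) := by rw [integral_comp_eq_of_mp hS hΦm]

/-- The slice integral `x ↦ ∫ Ψ(x,a) H(x,a) Ψ(a, S x) da`: measurability. [folklore] -/
theorem measurable_slice0 (hΨm : Measurable (uncurry Ψ)) {H : Y → Y → ℝ} (hH : Measurable (uncurry H)) {S : Y → Y} (hS : Measurable S) :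
    Measurable fun x => ∫ a, Ψ x a * H x a * Ψ a (S x) ∂ρ :=
  (((hΨm.mul hH).mul (hΨm.comp (measurable_snd.prodMk (hS.comp measurable_fst)))).stronglyMeasurable.integral_prod_right' (ν := ρ)).measurable

/-- The slice integrand is integrable in `a`. [folklore] -/
theorem integrable_slice0_integrand (hΨm : Measurable (uncurry Ψ)) (hΨb : ∀ x a, |Ψ x a| ≤ CΨ) {H : Y → Y → ℝ} (hH : Measurable (uncurry H))
    {CH : ℝ} (hHb : ∀ x a, |H x a| ≤ CH) (S : Y → Y) (x : Y) : Integrable (fun a => Ψ x a * H x a * Ψ a (S x)) ρ := by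
  have hm : Measurable fun a => Ψ x a * H x a * Ψ a (S x) :=
    (((hΨm.comp (measurable_const.prodMk measurable_id)).mul (hH.comp (measurable_const.prodMk measurable_id))).mul
      (hΨm.comp (measurable_id.prodMk measurable_const)))
  refine Integrable.of_bound hm.aestronglyMeasurable (CΨ * CH * CΨ) (ae_of_all _ fun a => ?_)
  rw [Real.norm_eq_abs, abs_mul, abs_mul]
  have h0 : 0 ≤ CΨ := (abs_nonneg _).trans (hΨb x a)
  exact mul_le_mul (mul_le_mul (hΨb x a) (hHb x a) (abs_nonneg _) h0) (hΨb a (S x)) (abs_nonneg _) (mul_nonneg h0 ((abs_nonneg _).trans (hHb x a)))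

/-- The slice integral is integrable in `x`. [folklore] -/
theorem integrable_slice0 (hΨm : Measurable (uncurry Ψ)) (hΨb : ∀ x a, |Ψ x a| ≤ CΨ) {H : Y → Y → ℝ} (hH : Measurable (uncurry H))
    {CH : ℝ} (hHb : ∀ x a, |H x a| ≤ CH) {S : Y → Y} (hS : Measurable S) : Integrable (fun x => ∫ a, Ψ x a * H x a * Ψ a (S x) ∂ρ) ρ := by
  refine Integrable.of_bound (measurable_slice0 (ρ := ρ) hΨm hH hS).aestronglyMeasurable (CΨ * CH * CΨ * ρ.real univ) (ae_of_all _ fun x => ?_)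
  have h := norm_integral_le_of_norm_le_const (μ := ρ) (f := fun a => Ψ x a * H x a * Ψ a (S x)) (C := CΨ * CH * CΨ)
    (ae_of_all _ fun a => by
      rw [Real.norm_eq_abs, abs_mul, abs_mul]
      have h0 : 0 ≤ CΨ := (abs_nonneg _).trans (hΨb x a)
      exact mul_le_mul (mul_le_mul (hΨb x a) (hHb x a) (abs_nonneg _) h0) (hΨb a (S x)) (abs_nonneg _)
        (mul_nonneg h0 ((abs_nonneg _).trans (hHb x a))))
  exact h

/-- Monotonicity of the even ring weight in the insertion. [folklore] -/
theorem weight0_mono (hΨm : Measurable (uncurry Ψ)) (hΨb : ∀ x a, |Ψ x a| ≤ CΨ) (hΨ0 : ∀ x a, 0 ≤ Ψ x a)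
    {H H' : Y → Y → ℝ} (hH : Measurable (uncurry H)) (hH' : Measurable (uncurry H')) {CH CH' : ℝ} (hHb : ∀ x a, |H x a| ≤ CH)
    (hH'b : ∀ x a, |H' x a| ≤ CH') (hle : ∀ x a, H x a ≤ H' x a) {S : Y → Y} (hS : Measurable S) :
    ∫ x, ∫ a, Ψ x a * H x a * Ψ a (S x) ∂ρ ∂ρ ≤ ∫ x, ∫ a, Ψ x a * H' x a * Ψ a (S x) ∂ρ ∂ρ := by
  refine integral_mono (integrable_slice0 hΨm hΨb hH hHb hS) (integrable_slice0 hΨm hΨb hH' hH'b hS) fun x => ?_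
  refine integral_mono (integrable_slice0_integrand hΨm hΨb hH hHb S x) (integrable_slice0_integrand hΨm hΨb hH' hH'b S x) fun a => ?_
  exact mul_le_mul_of_nonneg_right (mul_le_mul_of_nonneg_left (hle x a) (hΨ0 x a)) (hΨ0 a (S x))

/-- Additivity of the even ring weight in the insertion. [folklore] -/
theorem weight0_add (hΨm : Measurable (uncurry Ψ)) (hΨb : ∀ x a, |Ψ x a| ≤ CΨ)
    {H H' : Y → Y → ℝ} (hH : Measurable (uncurry H)) (hH' : Measurable (uncurry H')) {CH CH' : ℝ} (hHb : ∀ x a, |H x a| ≤ CH)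
    (hH'b : ∀ x a, |H' x a| ≤ CH') {S : Y → Y} (hS : Measurable S) :
    ∫ x, ∫ a, Ψ x a * (H x a + H' x a) * Ψ a (S x) ∂ρ ∂ρ =
      (∫ x, ∫ a, Ψ x a * H x a * Ψ a (S x) ∂ρ ∂ρ) + ∫ x, ∫ a, Ψ x a * H' x a * Ψ a (S x) ∂ρ ∂ρ := by
  rw [← integral_add (integrable_slice0 hΨm hΨb hH hHb hS) (integrable_slice0 hΨm hΨb hH' hH'b hS)]
  refine integral_congr_ae (ae_of_all _ fun x => ?_)
  dsimp only
  rw [← integral_add (integrable_slice0_integrand hΨm hΨb hH hHb S x) (integrable_slice0_integrand hΨm hΨb hH' hH'b S x)]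
  exact integral_congr_ae (ae_of_all _ fun a => by ring)

omit [IsFiniteMeasure ρ] in
/-- Factorised insertions in two-slot form. [folklore] -/
theorem weight0_eq_pq (f g : Y → Y → ℝ) (h : Y → Y → ℝ) (S : Y → Y) (hfg : ∀ x a, h x a = f x a * g x a) :
    ∫ x, ∫ a, Ψ x a * h x a * Ψ a (S x) ∂ρ ∂ρ = ∫ x, ∫ a, (Ψ x a * f x a) * (Ψ a (S x) * g x a) ∂ρ ∂ρ :=
  integral_congr_ae (ae_of_all _ fun x => integral_congr_ae (ae_of_all _ fun a => by dsimp only; rw [hfg]; ring))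

omit [MeasurableSpace Y] in
/-- The even bracket: base bit zero, or a flip on one of the two halves. [folklore] -/
theorem one_le_bracket0 {T : Y → Y} {O : Y → ℝ} (hOT : ∀ y, O (T y) = -O y) (x a : Y) :
    (1 : ℝ) ≤ {y | O y = 0}.indicator (fun _ => (1 : ℝ)) x + {b | O b ≠ O x}.indicator (fun _ => (1 : ℝ)) a +
      {b | O b ≠ O (T x)}.indicator (fun _ => (1 : ℝ)) a := by
  have h0 : ∀ (s : Set Y) (y : Y), 0 ≤ s.indicator (fun _ => (1 : ℝ)) y := fun s y => Set.indicator_nonneg (fun _ _ => zero_le_one) _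
  by_cases hx : O x = 0
  · have : {y | O y = 0}.indicator (fun _ => (1 : ℝ)) x = 1 := Set.indicator_of_mem (by exact hx) _
    linarith [h0 {b | O b ≠ O x} a, h0 {b | O b ≠ O (T x)} a]
  by_cases ha : O a = O x
  · have hne : O a ≠ O (T x) := by
      rw [ha, hOT]; intro h; exact hx (by linarith)
    have : {b | O b ≠ O (T x)}.indicator (fun _ => (1 : ℝ)) a = 1 := Set.indicator_of_mem (by exact hne) _
    linarith [h0 {y | O y = 0} x, h0 {b | O b ≠ O x} a]
  · have : {b | O b ≠ O x}.indicator (fun _ => (1 : ℝ)) a = 1 := Set.indicator_of_mem (by exact ha) _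
    linarith [h0 {y | O y = 0} x, h0 {b | O b ≠ O (T x)} a]

/-- ★ **Flux reflection, even ring.**  `∫Ψ(x,a)Ψ(a,Tx) ≤ (∫ΨΨ)^{1/2}·(2(∫Ψ𝟙_{flip}Ψ)^{1/2} + (∫𝟙_{O=0}ΨΨ)^{1/2})`. [folklore] -/
theorem twisted_le_even (hΨm : Measurable (uncurry Ψ)) (hΨb : ∀ x a, |Ψ x a| ≤ CΨ) (hΨ0 : ∀ x a, 0 ≤ Ψ x a) (hΨs : ∀ x a, Ψ x a = Ψ a x)
    {T : Y → Y} (hT : MeasurePreserving T ρ ρ) {O : Y → ℝ} (hOm : Measurable O) (hOT : ∀ y, O (T y) = -O y) :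
    ∫ x, ∫ a, Ψ x a * Ψ a (T x) ∂ρ ∂ρ ≤
      Real.sqrt (∫ x, ∫ a, Ψ x a * Ψ a x ∂ρ ∂ρ) *
        (2 * Real.sqrt (∫ x, ∫ a, Ψ x a * {b | O b ≠ O x}.indicator (fun _ => (1 : ℝ)) a * Ψ a x ∂ρ ∂ρ) +
          Real.sqrt (∫ x, ∫ a, Ψ x a * {y | O y = 0}.indicator (fun _ => (1 : ℝ)) x * Ψ a x ∂ρ ∂ρ)) := by
  have hTm : Measurable T := hT.measurable
  set z : Y → ℝ := fun x => {y | O y = 0}.indicator (fun _ => (1 : ℝ)) x with hz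
  set fl : Y → Y → ℝ := fun x b => {b | O b ≠ O x}.indicator (fun _ => (1 : ℝ)) b with hfl
  have hzm : Measurable z := measurable_const.indicator (measurableSet_eq_fun hOm measurable_const)
  have hflm : Measurable (uncurry fl) := measurable_flipInd hOm
  have mH0 : Measurable (uncurry fun _ _ : Y => (1 : ℝ)) := measurable_const
  have mZ : Measurable (uncurry fun x _ : Y => z x) := hzm.comp measurable_fst
  have mF2 : Measurable (uncurry fun x a : Y => fl (T x) a) := hflm.comp ((hTm.comp measurable_fst).prodMk measurable_snd)
  have b1 : ∀ (s : Set Y) (y : Y), |s.indicator (fun _ => (1 : ℝ)) y| ≤ 1 := abs_ind_le_one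
  have bZ : ∀ x a : Y, |z x| ≤ 1 := fun x _ => b1 _ x
  have bF1 : ∀ x a : Y, |fl x a| ≤ 1 := fun x a => b1 _ a
  have bF2 : ∀ x a : Y, |fl (T x) a| ≤ 1 := fun x a => b1 _ a
  have bH0 : ∀ x a : Y, |(1 : ℝ)| ≤ 1 := fun _ _ => by simp
  have bZF : ∀ x a : Y, |z x + fl x a| ≤ 2 := fun x a => by linarith [abs_add_le (z x) (fl x a), bZ x a, bF1 x a]
  have bBr : ∀ x a : Y, |z x + fl x a + fl (T x) a| ≤ 3 := fun x a => by
    linarith [abs_add_le (z x + fl x a) (fl (T x) a), bZF x a, bF2 x a]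
  have hz0 : ∀ x a : Y, 0 ≤ z x := fun x _ => ind_nonneg _ x
  have hz1 : ∀ x a : Y, z x ≤ 1 := fun x _ => ind_le_one _ x
  have hfl0 : ∀ x a : Y, 0 ≤ fl x a := fun x a => ind_nonneg _ a
  have hfl1 : ∀ x a : Y, fl x a ≤ 1 := fun x a => ind_le_one _ a
  -- Step 1/2: bracket and split
  have step1 : ∫ x, ∫ a, Ψ x a * 1 * Ψ a (T x) ∂ρ ∂ρ ≤ ∫ x, ∫ a, Ψ x a * (z x + fl x a + fl (T x) a) * Ψ a (T x) ∂ρ ∂ρ :=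
    weight0_mono (H := fun _ _ => (1 : ℝ)) (H' := fun x a => z x + fl x a + fl (T x) a) hΨm hΨb hΨ0 mH0 ((mZ.add hflm).add mF2) bH0 bBr
      (fun x a => one_le_bracket0 hOT x a) hTm
  have e0 : ∫ x, ∫ a, Ψ x a * 1 * Ψ a (T x) ∂ρ ∂ρ = ∫ x, ∫ a, Ψ x a * Ψ a (T x) ∂ρ ∂ρ := by simp only [mul_one]
  have e2a : ∫ x, ∫ a, Ψ x a * (z x + fl x a + fl (T x) a) * Ψ a (T x) ∂ρ ∂ρ =
      (∫ x, ∫ a, Ψ x a * (z x + fl x a) * Ψ a (T x) ∂ρ ∂ρ) + ∫ x, ∫ a, Ψ x a * fl (T x) a * Ψ a (T x) ∂ρ ∂ρ :=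
    weight0_add (H := fun x a => z x + fl x a) (H' := fun x a => fl (T x) a) hΨm hΨb (mZ.add hflm) mF2 bZF bF2 hTm
  have e2b : ∫ x, ∫ a, Ψ x a * (z x + fl x a) * Ψ a (T x) ∂ρ ∂ρ =
      (∫ x, ∫ a, Ψ x a * z x * Ψ a (T x) ∂ρ ∂ρ) + ∫ x, ∫ a, Ψ x a * fl x a * Ψ a (T x) ∂ρ ∂ρ :=
    weight0_add (H := fun x _ => z x) (H' := fun x a => fl x a) hΨm hΨb mZ hflm bZ bF1 hTm
  -- Step 3: Cauchy–Schwarz terms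
  have E1 := cs_term0 (ρ := ρ) (f := fun x _ => z x) (g := fun _ _ => (1 : ℝ)) hΨm hΨb hΨ0 hΨs hT mZ mH0 hz0 hz1
    (fun _ _ => zero_le_one) (fun _ _ => le_rfl)
  have cz1 : ∫ x, ∫ a, Ψ x a * z x * Ψ a (T x) ∂ρ ∂ρ = ∫ x, ∫ a, (Ψ x a * z x) * (Ψ a (T x) * 1) ∂ρ ∂ρ :=
    weight0_eq_pq (fun x _ => z x) (fun _ _ => (1 : ℝ)) (fun x _ => z x) T (fun _ _ => by ring)
  have cz2 : ∫ x, ∫ a, Ψ x a * z x * Ψ a x ∂ρ ∂ρ = ∫ x, ∫ a, (Ψ x a * z x) * (Ψ a x * z x) ∂ρ ∂ρ :=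
    weight0_eq_pq (fun x _ => z x) (fun x _ => z x) (fun x _ => z x) (fun x => x) (fun x _ => by rw [ind_mul_self])
  have c11 : ∫ x, ∫ a, Ψ x a * Ψ a x ∂ρ ∂ρ = ∫ x, ∫ a, (Ψ x a * 1) * (Ψ a x * 1) ∂ρ ∂ρ := by simp only [mul_one]
  rw [← cz1, ← cz2, ← c11] at E1
  have E2 := cs_term0 (ρ := ρ) (f := fun x a => fl x a) (g := fun _ _ => (1 : ℝ)) hΨm hΨb hΨ0 hΨs hT hflm mH0 hfl0 hfl1
    (fun _ _ => zero_le_one) (fun _ _ => le_rfl)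
  have cf1 : ∫ x, ∫ a, Ψ x a * fl x a * Ψ a (T x) ∂ρ ∂ρ = ∫ x, ∫ a, (Ψ x a * fl x a) * (Ψ a (T x) * 1) ∂ρ ∂ρ :=
    weight0_eq_pq (fun x a => fl x a) (fun _ _ => (1 : ℝ)) (fun x a => fl x a) T (fun _ _ => by ring)
  have cf2 : ∫ x, ∫ a, Ψ x a * fl x a * Ψ a x ∂ρ ∂ρ = ∫ x, ∫ a, (Ψ x a * fl x a) * (Ψ a x * fl x a) ∂ρ ∂ρ :=
    weight0_eq_pq (fun x a => fl x a) (fun x a => fl x a) (fun x a => fl x a) (fun x => x) (fun x a => by rw [ind_mul_self])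
  rw [← cf1, ← cf2, ← c11] at E2
  have E3 := cs_term0 (ρ := ρ) (f := fun _ _ => (1 : ℝ)) (g := fun y b => fl y b) hΨm hΨb hΨ0 hΨs hT mH0 hflm
    (fun _ _ => zero_le_one) (fun _ _ => le_rfl) hfl0 hfl1
  have cg1 : ∫ x, ∫ a, Ψ x a * fl (T x) a * Ψ a (T x) ∂ρ ∂ρ = ∫ x, ∫ a, (Ψ x a * 1) * (Ψ a (T x) * fl (T x) a) ∂ρ ∂ρ :=
    weight0_eq_pq (fun _ _ => (1 : ℝ)) (fun x a => fl (T x) a) (fun x a => fl (T x) a) T (fun _ _ => by ring)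
  rw [← cg1, ← cf2, ← c11] at E3
  have total : ∫ x, ∫ a, Ψ x a * Ψ a (T x) ∂ρ ∂ρ ≤
      Real.sqrt (∫ x, ∫ a, Ψ x a * z x * Ψ a x ∂ρ ∂ρ) * Real.sqrt (∫ x, ∫ a, Ψ x a * Ψ a x ∂ρ ∂ρ) +
        Real.sqrt (∫ x, ∫ a, Ψ x a * fl x a * Ψ a x ∂ρ ∂ρ) * Real.sqrt (∫ x, ∫ a, Ψ x a * Ψ a x ∂ρ ∂ρ) +
        Real.sqrt (∫ x, ∫ a, Ψ x a * Ψ a x ∂ρ ∂ρ) * Real.sqrt (∫ x, ∫ a, Ψ x a * fl x a * Ψ a x ∂ρ ∂ρ) := by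
    linarith
  refine total.trans (le_of_eq ?_)
  ring

end Even

end Summit.QuantumFields.YangMills.Theorems.FemtoTransferGap.FluxReflection

end
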